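import Mathlib
import HarnessLib

/-!
# The wall of the Weil minimiser: three closed forms behind the inverse-square-root-log cusp

Helper file (`--supports stmt-RiemannHypothesis-0098`), elementary real analysis from Mathlib, no definitions.  Seat
rh-explicit-weil-5 gen12 (file of record `HOME/rh-explicit-weil-5/WEIL5-WALL.md`; sealed ledger PREREG-WALL-weil5-g12).

Context (documentation only; nothing below depends on it).  Weil's hermitian form on Yoshida's class `K(a)`, compressed to
`L²[-a, a]`, is `log|D| + (bounded smoothing terms) − log 2π`, where `log|D|` has the x-space kernel `½·f.p.|x − y|⁻¹`.
(1) A function with a one-sided limit `θ` at the wall gives `(log|D| u)(a − s) = (θ/2)·log(1/s) + O(1)`; balancing this against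
the interior part of the same kernel for a slowly varying profile `u(a − s) = G(log(1/s))` reads `T·G(T) − ½∫₀ᵀ G = O(1)`,
and among power laws `G(T) = T^κ` the left side is `T^{κ+1}(1 − 1/(2(κ+1)))` — it vanishes iff `κ = −1/2`
(`wallBalance_rpow`, `wallBalance_rpow_eq_zero_iff`): the exact eigenfunction has NO jump and decays like `(log 1/s)^{-1/2}`.
(2) Exactly: the half-line compression has Mellin symbol `(ψ(s) + ψ(1−s))/2`, so the local solutions of `log|D| u = λu + smooth`
are `C·𝔉(s·e^{λ})` with `𝔉(y) = (2πi)⁻¹∮ [Γ(s)/Γ(1−s)]^{1/2} y^{-s} ds`; wrapping the contour around the cut `(−1, 0)` gives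
`𝔉(y) = π^{-1/2} ∫₀¹ y^t dt/(Γ(1+t)·√(sin πt))`, whose density is `|Γ(−t)/Γ(1+t)|^{1/2}/π` by the reflection identity
`Γ(−t)·Γ(1+t) = −π/sin(πt)` (`Gamma_neg_mul_Gamma_one_add`, `Gamma_neg_div_Gamma_one_add`).
(3) The leading behaviour of that integral as `y → 0⁺` is the Laplace transform `∫₀^∞ t^{-1/2} e^{-tT} dt = √π·T^{-1/2}`
(`integral_rpow_neg_half_mul_exp_neg_mul`), i.e. `𝔉(y) ≈ [π(log(1/y) − γ)]^{-1/2}`; for the near-null Weil minimiser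
(`λ = log 2π` in these units) the wall profile is `C·𝔉(2πs)` with the universal scale `s₀ = e^{-γ}/(2π)`.

Standard axioms only; no `sorry`.
-/

set_option linter.dupNamespace false
set_option autoImplicit false

noncomputable section

open Real MeasureTheory Set intervalIntegral

namespace Summit.RiemannHypothesis.RiemannHypothesis.Theorems.WeilWallCusp

/-! ### (1) The balance identity that selects the exponent `−1/2` -/

/-- For `κ > −1` and `T > 0`: `T·T^κ − ½∫₀ᵀ t^κ dt = T^{κ+1}·(1 − 1/(2(κ+1)))`. -/
theorem wallBalance_rpow (κ T : ℝ) (hκ : -1 < κ) (hT : 0 < T) :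
    T * T ^ κ - (1 / 2) * ∫ t in (0 : ℝ)..T, t ^ κ = T ^ (κ + 1) * (1 - 1 / (2 * (κ + 1))) := by
  have hκ1 : κ + 1 ≠ 0 := by linarith
  rw [integral_rpow (Or.inl hκ), Real.zero_rpow hκ1, sub_zero, Real.rpow_add hT, Real.rpow_one]
  field_simp

/-- The balance vanishes at some (equivalently every) `T > 0` iff `κ = −1/2`: the inverse-square-root-log law. -/
theorem wallBalance_rpow_eq_zero_iff (κ T : ℝ) (hκ : -1 < κ) (hT : 0 < T) :
    T * T ^ κ - (1 / 2) * ∫ t in (0 : ℝ)..T, t ^ κ = 0 ↔ κ = -1 / 2 := by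
  rw [wallBalance_rpow κ T hκ hT]
  have hpos : 0 < T ^ (κ + 1) := Real.rpow_pos_of_pos hT _
  have hκ1 : 0 < κ + 1 := by linarith
  constructor
  · intro h
    rcases mul_eq_zero.mp h with h0 | h1
    · exact absurd h0 hpos.ne'
    · have : 2 * (κ + 1) = 1 := by
        field_simp at h1
        linarith
      linarith
  · intro h
    subst h
    norm_num

/-- At `κ = −1/2` explicitly: `T·T^{-1/2} = ½∫₀ᵀ t^{-1/2} dt` (`= √T`). -/
theorem wallBalance_neg_half (T : ℝ) (hT : 0 < T) :
    T * T ^ (-1 / 2 : ℝ) = (1 / 2) * ∫ t in (0 : ℝ)..T, t ^ (-1 / 2 : ℝ) := by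
  have h := (wallBalance_rpow_eq_zero_iff (-1 / 2) T (by norm_num) hT).mpr rfl
  linarith

/-! ### (2) The reflection identity behind the cut density `1/(Γ(1+t)√(sin πt))` -/

/-- `Γ(−t)·Γ(1+t) = −π / sin(πt)` for every real `t` (Euler reflection at `s = −t`; both sides are `0` in Mathlib's
conventions when `sin(πt) = 0`). -/
theorem Gamma_neg_mul_Gamma_one_add (t : ℝ) :
    Real.Gamma (-t) * Real.Gamma (1 + t) = -(π / Real.sin (π * t)) := by
  have h := Real.Gamma_mul_Gamma_one_sub (-t)
  rw [sub_neg_eq_add, mul_neg, Real.sin_neg, div_neg] at h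
  exact h

/-- On the cut `0 < t < 1`: `Γ(−t)/Γ(1+t) = −π/(sin(πt)·Γ(1+t)²)` — negative, so `[Γ(s)/Γ(1−s)]^{1/2}` is purely imaginary on
`s ∈ (−1, 0)` and its modulus is `√π/(Γ(1+t)·√(sin πt))`. -/
theorem Gamma_neg_div_Gamma_one_add (t : ℝ) (ht : -1 < t) :
    Real.Gamma (-t) / Real.Gamma (1 + t) = -(π / (Real.sin (π * t) * Real.Gamma (1 + t) ^ 2)) := by
  have hG : Real.Gamma (1 + t) ≠ 0 := (Real.Gamma_pos_of_pos (by linarith)).ne'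
  have h := Gamma_neg_mul_Gamma_one_add t
  rw [show Real.Gamma (-t) / Real.Gamma (1 + t) = Real.Gamma (-t) * Real.Gamma (1 + t) / Real.Gamma (1 + t) ^ 2 by
        rw [pow_two, mul_div_mul_right _ _ hG], h, neg_div, div_div]

/-- The modulus identity on the cut: `|Γ(−t)/Γ(1+t)| = π/(sin(πt)·Γ(1+t)²)` for `0 < t < 1`. -/
theorem abs_Gamma_neg_div_Gamma_one_add (t : ℝ) (ht0 : 0 < t) (ht1 : t < 1) :
    |Real.Gamma (-t) / Real.Gamma (1 + t)| = π / (Real.sin (π * t) * Real.Gamma (1 + t) ^ 2) := by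
  have hsin : 0 < Real.sin (π * t) := by
    apply Real.sin_pos_of_pos_of_lt_pi
    · positivity
    · nlinarith [Real.pi_pos]
  have hG : 0 < Real.Gamma (1 + t) := Real.Gamma_pos_of_pos (by linarith)
  rw [Gamma_neg_div_Gamma_one_add t (by linarith), abs_neg, abs_of_pos]
  positivity

/-! ### (3) The Laplace transform giving the leading law `[π(log(1/y) − γ)]^{-1/2}` -/

/-- `∫₀^∞ t^{-1/2} e^{-Tt} dt = √π · (1/T)^{1/2}` for `T > 0`. -/
theorem integral_rpow_neg_half_mul_exp_neg_mul (T : ℝ) (hT : 0 < T) :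
    ∫ t in Ioi (0 : ℝ), t ^ (-(1 / 2) : ℝ) * Real.exp (-(T * t)) = Real.sqrt π * (1 / T) ^ (1 / 2 : ℝ) := by
  have h := Real.integral_rpow_mul_exp_neg_mul_Ioi (a := 1 / 2) (r := T) (by norm_num) hT
  have he : ((1 : ℝ) / 2 - 1) = -(1 / 2) := by norm_num
  rw [he, Real.Gamma_one_half_eq] at h
  rw [h, mul_comm]

/-- The same with the leading cusp constant made explicit: `(1/π)·∫₀^∞ (πt)^{-1/2}… ` form, i.e.
`π^{-1/2}·∫₀^∞ t^{-1/2} e^{-Tt} dt · π^{-1/2}·… = (π T)^{-1/2}`: here as `(∫ …)/π = (1/T)^{1/2}/√π`. -/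
theorem integral_rpow_neg_half_mul_exp_neg_mul_div_pi (T : ℝ) (hT : 0 < T) :
    (∫ t in Ioi (0 : ℝ), t ^ (-(1 / 2) : ℝ) * Real.exp (-(T * t))) / π = (1 / T) ^ (1 / 2 : ℝ) / Real.sqrt π := by
  rw [integral_rpow_neg_half_mul_exp_neg_mul T hT]
  have hπ : 0 < π := Real.pi_pos
  have hs : Real.sqrt π ≠ 0 := (Real.sqrt_pos.mpr hπ).ne'
  rw [div_eq_div_iff hπ.ne' hs]
  calc Real.sqrt π * (1 / T) ^ (1 / 2 : ℝ) * Real.sqrt π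
      = (Real.sqrt π * Real.sqrt π) * (1 / T) ^ (1 / 2 : ℝ) := by ring
    _ = π * (1 / T) ^ (1 / 2 : ℝ) := by rw [Real.mul_self_sqrt hπ.le]
    _ = (1 / T) ^ (1 / 2 : ℝ) * π := by ring

end Summit.RiemannHypothesis.RiemannHypothesis.Theorems.WeilWallCusp

end
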